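import Mathlib
import HarnessLib
import Literature.Probability.MarkovChains.LiftingMixingTimeBounds
import Literature.Probability.MarkovChains.SkewDetailedBalance

/-!
# The skew-detailed-balance lifted kernel IS a lifting of the reversible mixture `½(T₊ + T₋)`; hence the Chen–Lovász–Pak square-root limit applies to it (Vucelja 2016 §5, §7; Andrieu–Livingstone 2021 §3.3)

HONEST FRAMING: exact (Metropolis-corrected) sampling algorithms for lattice gauge theory; figures
of merit are autocorrelation/cost numbers at stated couplings and volumes; no continuum-physics claim.

Sources.  M. Vucelja, *Lifting — a nonreversible Markov chain Monte Carlo algorithm*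
[Vucelja2016] §5 "Lifting": "'Lifting' is an idea that originated in computer science – we increase
the phase space in order to create more biases and explore the now enlarged phase space more
efficiently than we would explore the original space [CLP00, Diaconis:2000vi]. Here we show how to
implement lifting for discrete Markov processes … We define a larger space `Ω̃ = Ω × {1,−1}` … we
impose skew-detailed balance `π̃(x_ξ)P̃(x_ξ,y_ξ) = π̃(y_{−ξ})P̃(y_{−ξ},x_{−ξ})` for `π̃ = ½(π,π)`";
§7: "Chen, Lovász and Pak show in [CLP00] that lifting can at most introduce a square root
improvement of the convergence time."  C. Andrieu, S. Livingstone [AndrieuLivingstone2021] §3.3: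
the sub-stochastic kernels `T₊, T₋` with (5) `π(dx)T_v(x,dy) = π(dy)T_{−v}(y,dx)`, the reversible
MIXTURE (6) `P = ½T₊ + ½T₋ + δ_x(1 − ½T₊(x,X) − ½T₋(x,X))` and the lifted kernel `P^lifted` on
`X × {−1,1}` (the tree's `liftedMH T ρ`, `SkewDetailedBalance.lean`).  Chen–Lovász–Pak liftings and
their conductance / mixing-time limits are the tree's `IsLifting`, `LiftingMixingTimeBounds.lean`
[ChenLovaszPak1999].

## Content (PROVED; finite `X`)
* `mixtureKernel T` — the kernel (6) as a named function (the lambda of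
  `mixtureMH_detailedBalance`), `mixtureKernel_detailedBalance` (restates that theorem);
* `sum_liftFiber_fst` — a fibre of `Prod.fst : X × Bool → X` is the pair `{(u,tt),(u,ff)}`;
* **`liftedMH_isLifting`**: for EVERY `π, T, ρ`, `IsLifting Prod.fst π (mixtureKernel T) (liftLaw π)
  (liftedMH T ρ)` — the ergodic flows of `P^lifted` under `π ⊗ ½` collapse onto those of the
  mixture (6) under `π` (the switching terms `ρ` cancel inside each fibre); consequently every
  result of `LiftingMixingTimeBounds.lean` applies verbatim: e.g. `liftedMH_one_le_mul_bottleneckRatioStar`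
  (`1 ≤ 4 t Φ⋆(P)` for every `t` at which `P^lifted` is `¼`-mixed from all starts) — the
  square-root limit of [CLP00] for this family of non-reversible samplers.
* `directionalMHRate q π` — the Metropolis–Hastings sub-kernels `T_v = (1 ∧ r_v) q_v` of §3.3 in
  flux form, `directionalMHRate_h5` (they satisfy (5)), `directionalMHRate_bounds`;
* `guidedWalk T = liftedMH T (1 − T_v(x,X))` — Gustafson's guided walk Metropolis (AL21 Example 6)
  [Gustafson1998]: `guidedWalk_rate_eq7`, `guidedWalk_isStationary` (π ⊗ ½ invariant under (5)),
  `guidedWalk_isLifting`.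
NOT CLAIMED: any statement that lifting DOES accelerate (Vucelja: "It is an open question whether
and when it will make it faster"); AL21 Theorem 7 (`var_λ(f, P^lifted) ≤ var_λ(f, P)`) is not typed.
-/

namespace Literature.Probability.MarkovChains

open Finset

variable {X : Type*} [Fintype X] [DecidableEq X]

/-- The reversible MIXTURE (6) of the two sub-kernels:
`P(x,y) = ½T₊(x,y) + ½T₋(x,y) + 𝟙[y = x](1 − ½T₊(x,X) − ½T₋(x,X))`.
[cite: AndrieuLivingstone2021, §3.3 eq. (6)] -/
noncomputable def mixtureKernel (T : Bool → X → X → ℝ) : X → X → ℝ := fun x y =>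
  (1 / 2) * T true x y + (1 / 2) * T false x y
    + (if y = x then 1 - (1 / 2) * ∑ z, T true x z - (1 / 2) * ∑ z, T false x z else 0)

/-- (6) is `π`-reversible under (5). [cite: AndrieuLivingstone2021, §3.3 eq. (6)] -/
theorem mixtureKernel_detailedBalance {π : X → ℝ} {T : Bool → X → X → ℝ}
    (h5 : ∀ v x y, π x * T v x y = π y * T (!v) y x) : DetailedBalance π (mixtureKernel T) :=
  mixtureMH_detailedBalance π T h5

/-- Rows of (6) sum to one. [cite: AndrieuLivingstone2021, §3.3 eq. (6)] -/
theorem mixtureKernel_rowSum (T : Bool → X → X → ℝ) (x : X) : ∑ y, mixtureKernel T x y = 1 := by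
  simp only [mixtureKernel, sum_add_distrib, sum_ite_eq', mem_univ, if_true, ← mul_sum]
  ring

/-- A fibre of the coordinate projection `X × Bool → X` is the pair of replicas `(u,+), (u,−)`.
[cite: Vucelja2016, §5 ("`Ω̃ = Ω × {1,−1}`")] -/
theorem sum_liftFiber_fst (f : X × Bool → ℝ) (u : X) :
    ∑ a ∈ liftFiber (Prod.fst : X × Bool → X) u, f a = f (u, true) + f (u, false) := by
  have hfib : liftFiber (Prod.fst : X × Bool → X) u = {(u, true), (u, false)} := by
    ext ⟨x, b⟩
    simp only [liftFiber, mem_filter, mem_univ, true_and, mem_insert, mem_singleton, Prod.mk.injEq]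
    cases b <;> simp [eq_comm]
  rw [hfib, sum_pair (by simp)]

/-- **The skew-detailed-balance lifted kernel is a Chen–Lovász–Pak lifting of the mixture (6)**:
`π(u)P(u,v) = Σ_{b,b'} (π(u)/2) P^lifted((u,b),(v,b'))` for all `u, v` — for every weight `π`,
every pair of sub-kernels `T_±` and every switching rates `ρ` (the `ρ`-terms cancel inside each
fibre).  Hence `P^lifted` can improve the mixing / conductance profile of (6) by at most the
square root (`LiftingMixingTimeBounds.lean`). [cite: Vucelja2016, §5 and §7 ("lifting can at most
introduce a square root improvement of the convergence time"); AndrieuLivingstone2021, §3.3;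
ChenLovaszPak1999] -/
theorem liftedMH_isLifting (π : X → ℝ) (T : Bool → X → X → ℝ) (ρ : Bool → X → ℝ) :
    IsLifting (Prod.fst : X × Bool → X) π (mixtureKernel T) (liftLaw π) (liftedMH T ρ) := by
  intro u v
  simp only [sum_liftFiber_fst, liftLaw, liftedMH, mixtureKernel]
  by_cases hv : v = u
  · subst hv; simp; ring
  · simp [hv]; ring

/-- COROLLARY (square-root limit for the lifted sampler, conductance form): under (5) and (7)
(so that `π ⊗ ½` is invariant for `P^lifted`), if `P^lifted` is `¼`-close to `π ⊗ ½` in the worst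
case at time `t` then `1 ≤ 4 t Φ⋆(P)` for the mixture `P` (6) — no lifting of this kind beats
`1/(4Φ⋆)` of the collapsed reversible chain. [cite: Vucelja2016, §7 ("lifting can at most introduce
a square root improvement of the convergence time"); ChenLovaszPak1999, §3 (via
ApersTicozziSarlette2017 Thm 3, `LiftingMixingTimeBounds.lean`); AndrieuLivingstone2021, §3.3] -/
theorem liftedMH_one_le_mul_bottleneckRatioStar {π : X → ℝ} (hπ0 : ∀ x, 0 ≤ π x)
    (hπ1 : ∑ x, π x = 1) {T : Bool → X → X → ℝ} {ρ : Bool → X → ℝ}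
    (hP : IsRowStochastic (mixtureKernel T)) (hQ : IsRowStochastic (liftedMH T ρ))
    (h5 : ∀ v x y, π x * T v x y = π y * T (!v) y x)
    (h7 : ∀ v x, ρ v x - ρ (!v) x = ∑ z, T (!v) x z - ∑ z, T v x z)
    (hX : ∃ S : Finset X, 0 < ∑ x ∈ S, π x ∧ ∑ x ∈ S, π x ≤ 1 / 2) {t : ℕ}
    (ht : worstTvDist (liftedMH T ρ) (liftLaw π) t ≤ 1 / 4) :
    1 ≤ 4 * t * bottleneckRatioStar π (mixtureKernel T) :=
  (liftedMH_isLifting π T ρ).one_le_mul_bottleneckRatioStar hP hQ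
    (liftedMH_isStationary π T ρ h5 h7) (fun a => div_nonneg (hπ0 a.1) zero_le_two)
    (by rw [Fintype.sum_prod_type]; simp only [liftLaw, Fintype.univ_bool, sum_insert, mem_singleton,
          Bool.true_eq_false, not_false_eq_true, sum_singleton]; simp_rw [add_halves]; exact hπ1)
    hX ht

/-! ## The Metropolis–Hastings sub-kernels of §3.3 satisfy (5) -/

/-- The directional METROPOLIS–HASTINGS SUB-KERNELS of §3.3: with proposals `q_v(x,dy)` and
`r_v(x,y) := dγ_{−v}ᵀ/dγ_v (x,y) = π(y)q_{−v}(y,x)/(π(x)q_v(x,y))`,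
`T_v(x,dy) = (1 ∧ r_v(x,y)) q_v(x,dy)` — written in the tree's flux form
`min (q v x y) (π y q (−v) y x / π x)` (cf. `mhRate`). [cite: AndrieuLivingstone2021, §3.3 (the
display before (6), "satisfies (5) (see Algorithm 3)")] -/
noncomputable def directionalMHRate (q : Bool → X → X → ℝ) (π : X → ℝ) : Bool → X → X → ℝ :=
  fun v x y => min (q v x y) (π y * q (!v) y x / π x)

omit [Fintype X] [DecidableEq X] in
/-- `π(x)T_v(x,y) = min(π(x)q_v(x,y), π(y)q_{−v}(y,x))`. [cite: AndrieuLivingstone2021, §3.3] -/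
theorem mul_directionalMHRate {π : X → ℝ} (hπ : ∀ x, 0 < π x) (q : Bool → X → X → ℝ)
    (v : Bool) (x y : X) :
    π x * directionalMHRate q π v x y = min (π x * q v x y) (π y * q (!v) y x) := by
  unfold directionalMHRate
  rw [(monotone_mul_left_of_nonneg (hπ x).le).map_min]
  congr 1
  rw [mul_div_assoc', mul_div_cancel_left₀ _ (hπ x).ne']

omit [Fintype X] [DecidableEq X] in
/-- **The MH sub-kernels satisfy (5)**: `π(x)T_v(x,y) = π(y)T_{−v}(y,x)` ("satisfies (5)").
[cite: AndrieuLivingstone2021, §3.3 (display before (6))] -/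
theorem directionalMHRate_h5 {π : X → ℝ} (hπ : ∀ x, 0 < π x) (q : Bool → X → X → ℝ)
    (v : Bool) (x y : X) :
    π x * directionalMHRate q π v x y = π y * directionalMHRate q π (!v) y x := by
  rw [mul_directionalMHRate hπ, mul_directionalMHRate hπ, Bool.not_not, min_comm]

omit [Fintype X] [DecidableEq X] in
/-- `0 ≤ T_v ≤ q_v` entrywise (`q ≥ 0`, `π > 0`). [cite: AndrieuLivingstone2021, §3.3] -/
theorem directionalMHRate_bounds {π : X → ℝ} (hπ : ∀ x, 0 < π x) {q : Bool → X → X → ℝ}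
    (hq : ∀ v x y, 0 ≤ q v x y) (v : Bool) (x y : X) :
    0 ≤ directionalMHRate q π v x y ∧ directionalMHRate q π v x y ≤ q v x y :=
  ⟨le_min (hq v x y) (div_nonneg (mul_nonneg (hπ y).le (hq (!v) y x)) (hπ x).le), min_le_left _ _⟩

/-! ## Example 6: Gustafson's guided walk Metropolis = the lifted kernel with full switching -/

/-- **Gustafson's GUIDED WALK METROPOLIS** (AL21 Example 6):
`P_GRW((v,x); (w,y)) = T_v(x,y)𝟙[w = v] + δ_x(y)𝟙[w = −v](1 − T_v(x,X))` — the lifted kernel with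
the full switching rate `ρ_v(x) = 1 − T_v(x,X)` (reverse direction exactly upon rejection).
[cite: AndrieuLivingstone2021, §3.3 Example 6 (Gustafson 1998); Gustafson1998] -/
noncomputable def guidedWalk (T : Bool → X → X → ℝ) : X × Bool → X × Bool → ℝ :=
  liftedMH T fun v x => 1 - ∑ z, T v x z

omit [DecidableEq X] in
/-- The full switching rate satisfies (7): `ρ_v(x) − ρ_{−v}(x) = T_{−v}(x,X) − T_v(x,X)`.
[cite: AndrieuLivingstone2021, §3.3 eq. (7) and Example 6] -/
theorem guidedWalk_rate_eq7 (T : Bool → X → X → ℝ) (v : Bool) (x : X) :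
    (1 - ∑ z, T v x z) - (1 - ∑ z, T (!v) x z) = ∑ z, T (!v) x z - ∑ z, T v x z := by ring

/-- The guided walk leaves `π ⊗ ½` invariant under (5) (skew detailed balance, Proposition 1).
[cite: AndrieuLivingstone2021, §3.3 Example 6 with Prop. 3 / eq. (5); Gustafson1998] -/
theorem guidedWalk_isStationary (π : X → ℝ) {T : Bool → X → X → ℝ}
    (h5 : ∀ v x y, π x * T v x y = π y * T (!v) y x) : IsStationary (liftLaw π) (guidedWalk T) :=
  liftedMH_isStationary π T _ h5 (guidedWalk_rate_eq7 T)

/-- … and it is a Chen–Lovász–Pak lifting of the reversible mixture (6), like every `P^lifted`.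
[cite: Vucelja2016, §5; AndrieuLivingstone2021, §3.3 Example 6] -/
theorem guidedWalk_isLifting (π : X → ℝ) (T : Bool → X → X → ℝ) :
    IsLifting (Prod.fst : X × Bool → X) π (mixtureKernel T) (liftLaw π) (guidedWalk T) :=
  liftedMH_isLifting π T _

end Literature.Probability.MarkovChains
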